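import Summits.BirchSwinnertonDyer.BirchSwinnertonDyer.Theorems.ManinLocalTwoThreeSameLevelTwistTransport
import Summits.BirchSwinnertonDyer.BirchSwinnertonDyer.Theorems.ManinLocalTwoThreeManinPrimeToThreeAtNineTwistCovered
import Summits.BirchSwinnertonDyer.BirchSwinnertonDyer.Theorems.ManinLocalTwoThreeOddUntwistReductions
import HarnessLib

/-!
# Route `ManinLocalTwoThree` (cell `bsd-f2-manin`): crux C3 `ManinPrimeToThreeAtNine` (stmt-BirchSwinnertonDyer-22968)
# REDUCED to Manin's conjecture at `3` on the TWIST-ORBIT-MINIMAL optimal classes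

The C3 twin of `ManinLocalTwoThreeManinOddAtFourTwistOrbitMinimal`. Seat p2 gen 0 reduced C3 to its globally
twist-minimal core `H₃ᵍ` (no semistable untwist at `3`, at an odd `q ≠ 3`, or at `2`;
`maninLocalTwoThree_maninPrimeToThreeAtNine_of_globallyTwistMinimal`). Every transport lemma of this seat is
prime-generic, so the same four EXACT additive transports shrink the C3 core as well: (iv) a `χ₋₄`-untwist to an
ADDITIVE-at-`2` class of lower conductor (`2⁴ ∣ N`; Connell–Pal), (v) an ALIGNED `χ±8`-untwist to a
lattice-optimal additive-at-`2` curve (`2⁶ ∣ N`) of lower conductor or smaller `|Δ_min|`, and (vi) an ALIGNED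
same-level `χ_{q*}`-untwist at ANY odd `q` with `q² ∣ N` — in particular `q = 3` itself, the `III ↔ III*`,
`II ↔ IV*`, `IV ↔ II*` partners at `9 ∣ N` — to a lattice-optimal curve with smaller `|Δ_min|` (THEOREM A clause 1).
Main theorem `maninLocalTwoThree_maninPrimeToThreeAtNine_of_twistOrbitMinimal`: the route decl BY NAME from ONE
hypothesis. Lexicographic induction on (level, `|Δ_min|`); `9 ∣ N` is inherited by every partner (all the
untwisting characters used off `q = 3` are unramified at `3`; the `q*`-partners are taken at the same level).

CENSUS of the residue (this seat's exact join of the cell table TWISTCENSUS2, alignment tested on a-invariants;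
optimal classes with `9 ∣ N ≤ 5·10⁵`): all 657 019 → `H₃ᵍ` 233 679 (seat p1: irr 214 840 + red 18 839) →
**TWIST-ORBIT-MINIMAL 92 797 (14.1 % of all; `W[3]`-irreducible 85 272, `W[3]`-reducible 7 525)**, by `v₃(N)`:
`2`: 32 477 · `3`: 41 162 · `4`: 12 943 · `5`: 6 215. The `χ₋₃` same-level clause alone takes `H₃ᵍ` to
123 757. What is left is Manin's conjecture at `3` for the optimal curves minimal for (conductor, `|Δ_min|`) in
their quadratic-twist class — OPEN; nothing here proves BSD or Manin's conjecture. Seat bsd-line-manin23-p2 (gen 2).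

References: [Stevens1989] Lemmas (5.2), (5.4); [Cesnavicius2018] Thm. 1.2; [Pal2012] Prop. 2.4, Lemma 3.1;
[SilvermanATAEC1994] IV.9.4.
-/

set_option autoImplicit false
set_option linter.dupNamespace false

noncomputable section

open scoped MatrixGroups ModularForm Classical NumberField

namespace Summit.BirchSwinnertonDyer.BirchSwinnertonDyer.Theorems

open CongruenceSubgroup WeierstrassCurve IsDedekindDomain IsDedekindDomain.HeightOneSpectrum
  Rat.HeightOneSpectrum Literature.NumberTheory.Automorphic
  Literature.NumberTheory.EllipticCurves Literature.NumberTheory.EllipticCurves.ModularForms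
  Summit.BirchSwinnertonDyer.Rank1Residual.ManinAdditive

/-! ## §1 `9 ∣ N` is inherited along untwists unramified at `3` -/

/-- `3² ∣ N(A)` is inherited along a dyadic twist `W ∼ A ⊗ ℚ(√d)`, `d ∈ {−1, 2, −2}` (the twist is
unramified at `3`; conductor exponents at `3` agree, granted modularity for the isogeny invariance).
[cite: SilvermanATAEC1994, IV.9.4 and Exercise 4.40] -/
theorem maninLocalTwoThree_nine_dvd_conductorNorm_of_isIsogenous_dyadicTwist (hnf : exists_isNewformOf)
    {d : ℤ} (hd : d = -1 ∨ d = 2 ∨ d = -2) {W A : WeierstrassCurve ℚ} [W.IsElliptic] [A.IsElliptic]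
    (htw : IsIsogenous W (A.quadraticTwist (d : ℚ))) (h9 : 3 ^ 2 ∣ W.conductorNorm ℤ) :
    3 ^ 2 ∣ A.conductorNorm ℤ := by
  have hmod : nonempty_modularParametrizationData :=
    maninLocalTwoThree_nonempty_modularParametrizationData_of_exists_isNewformOf hnf
  have hdne : d ≠ 0 := by rcases hd with rfl | rfl | rfl <;> norm_num
  have hd0 : (d : ℚ) ≠ 0 := by exact_mod_cast hdne
  haveI : (A.quadraticTwist (d : ℚ)).IsElliptic := A.isElliptic_quadraticTwist hd0
  have hWV : W.conductorNorm ℤ = (A.quadraticTwist (d : ℚ)).conductorNorm ℤ :=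
    conductorNorm_eq_of_isIsogenous_of_modularity hmod _ _ htw
  have hfe : (A.quadraticTwist (d : ℚ)).conductorExponent ((primesEquiv (R := ℤ)).symm ⟨3, Nat.prime_three⟩) =
      A.conductorExponent ((primesEquiv (R := ℤ)).symm ⟨3, Nat.prime_three⟩) :=
    maninLocalTwoThree_conductorExponent_quadraticTwist_eq_of_ne_two A hd _
      (by rw [natGenerator_primesEquiv_symm Nat.prime_three]; norm_num)
  have h3W : 2 ≤ (W.conductorNorm ℤ).factorization 3 :=
    (Nat.prime_three.pow_dvd_iff_le_factorization (conductorNorm_pos_holds W).ne').mp h9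
  refine (Nat.prime_three.pow_dvd_iff_le_factorization (conductorNorm_pos_holds A).ne').mpr ?_
  have e1 := factorization_conductorNorm_primesEquiv_symm (A.quadraticTwist (d : ℚ)) ⟨3, Nat.prime_three⟩
  have e2 := factorization_conductorNorm_primesEquiv_symm A ⟨3, Nat.prime_three⟩
  simp only at e1 e2
  rw [e2, ← hfe, ← e1, ← hWV]
  exact h3W

/-- `3² ∣ N(W')` is inherited along an odd twist `W ∼ W' ⊗ ℚ(√q*)` with `q ≠ 3` (unramified at `3`).
[cite: SilvermanATAEC1994, IV.9.4 and Exercise 4.40] -/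
theorem maninLocalTwoThree_nine_dvd_conductorNorm_of_isIsogenous_twist_pStar (hnf : exists_isNewformOf)
    {q : ℕ} [Fact q.Prime] (hq2 : q ≠ 2) (hq3 : q ≠ 3)
    {W W' : WeierstrassCurve ℚ} [W.IsElliptic] [W'.IsElliptic]
    (htw : IsIsogenous W (W'.quadraticTwist (((-1 : ℤ) ^ (q / 2) * q : ℤ) : ℚ)))
    (h9 : 3 ^ 2 ∣ W.conductorNorm ℤ) : 3 ^ 2 ∣ W'.conductorNorm ℤ := by
  have hv3 : natGenerator ((primesEquiv (R := ℤ)).symm ⟨3, Nat.prime_three⟩) ≠ q := by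
    rw [natGenerator_primesEquiv_symm Nat.prime_three]; exact fun h ↦ hq3 h.symm
  have h3W : 2 ≤ (W.conductorNorm ℤ).factorization 3 :=
    (Nat.prime_three.pow_dvd_iff_le_factorization (conductorNorm_pos_holds W).ne').mp h9
  refine (Nat.prime_three.pow_dvd_iff_le_factorization (conductorNorm_pos_holds W').ne').mpr ?_
  have hf3 := maninLocalTwoThree_conductorExponent_eq_of_isIsogenous_twist_pStar hnf hq2 htw
    ((primesEquiv (R := ℤ)).symm ⟨3, Nat.prime_three⟩) hv3
  have e1 := factorization_conductorNorm_primesEquiv_symm W ⟨3, Nat.prime_three⟩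
  have e2 := factorization_conductorNorm_primesEquiv_symm W' ⟨3, Nat.prime_three⟩
  simp only at e1 e2
  rw [e2, ← hf3, ← e1]
  exact h3W

/-! ## §2 C3 ⟸ Manin at `3` on the TWIST-ORBIT-MINIMAL core -/

/-- **Crux C3 `ManinPrimeToThreeAtNine` ⟸ Manin's conjecture at `3` on the TWIST-ORBIT-MINIMAL optimal
classes** (one hypothesis, kernel-checked composition). Modulo the four printed facts, it suffices to prove
`3 ∤ c` for the lattice-optimal data `D` with `9 ∣ N` whose class admits (i) no `χ₋₃`-untwist to a class
semistable at `3`; (ii) no odd semistable untwist `χ_{q*}` (`q ≠ 2, 3`, `q² ∣ N`); (iii) no dyadic untwist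
(`4 ∣ N`, `d ∈ {−1, ±2}`) to a class semistable at `2`; (iv) no `χ₋₄`-untwist to an ADDITIVE-at-`2` class of
lower conductor `N' ∣ N` (`2⁴ ∣ N`); (v) no ALIGNED `χ±8`-untwist (`2⁶ ∣ N`) to a lattice-optimal
additive-at-`2` curve `A`, `N(A) ∣ N`, of lower conductor or `|Δ_min(A)| < |Δ_min(W)|`; (vi) no ALIGNED
same-level `χ_{q*}`-untwist (`q` odd, `q² ∣ N`, `q = 3` allowed) to a lattice-optimal `A` with
`C = u • (A ⊗ ℚ(√q*)) ∼ W` globally minimal, `Δ(C) = (q*)⁶ Δ(A)`, `|Δ_min(A)| < |Δ_min(W)|`.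
Lexicographic induction on (level, `|Δ_min|`) with the prime-generic transports at `p = 3`:
(i) `maninLocalTwoThree_maninPrimeToThreeAtNine_twistCovered`, (ii) `…_of_oddUntwist`,
(iii) `…_of_dyadicUntwist_semistable`, (iv) `…_of_additiveUntwist_negOne`, (v) `…_of_additiveUntwist_two_aligned`,
(vi) `…_of_untwist_pStar_aligned`. Residue census: 92 797 of the 657 019 optimal classes with `9 ∣ N ≤ 5·10⁵`
(irreducible 85 272, reducible 7 525). OPEN on that residue.
[cite: Stevens1989, Lemmas (5.2), (5.4)] [cite: Cesnavicius2018, Thm. 1.2] [cite: Pal2012, Prop. 2.4, Lemma 3.1] -/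
theorem maninLocalTwoThree_maninPrimeToThreeAtNine_of_twistOrbitMinimal
    (H : Literature.NumberTheory.EllipticCurves.ModularForms.mazur_not_dvd_maninConstant_of_odd →
      Literature.NumberTheory.EllipticCurves.ModularForms.abbesUllmo_not_dvd_maninConstant_of_not_dvd_level →
      Literature.NumberTheory.EllipticCurves.ModularForms.cesnavicius_not_two_dvd_maninConstant_of_two_dvd_level →
      Literature.NumberTheory.EllipticCurves.ModularForms.exists_isNewformOf →
      ∀ (W : WeierstrassCurve ℚ) [W.IsElliptic] [W.IsGloballyMinimal] {N : ℕ} [NeZero N]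
        (D : ModularParametrizationData W N),
        (∀ z ∈ D.L.lattice, ∃ w ∈ periodLattice D.f, z = D.c * w) → 3 ^ 2 ∣ N →
        ¬ (∃ (W' : WeierstrassCurve ℚ) (d : ℤ), W'.IsElliptic ∧ W'.IsGloballyMinimal ∧
          (d = -3) ∧ IsIsogenous W (W'.quadraticTwist (d : ℚ)) ∧
          ¬ 3 ^ 2 ∣ W'.conductorNorm ℤ) →
        ¬ (∃ (W' : WeierstrassCurve ℚ) (q : ℕ), W'.IsElliptic ∧ W'.IsGloballyMinimal ∧
          q.Prime ∧ q ≠ 2 ∧ q ≠ 3 ∧ q ^ 2 ∣ N ∧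
          IsIsogenous W (W'.quadraticTwist (((-1 : ℤ) ^ (q / 2) * q : ℤ) : ℚ)) ∧
          ¬ q ^ 2 ∣ W'.conductorNorm ℤ) →
        ¬ (∃ (W' : WeierstrassCurve ℚ) (d : ℤ), W'.IsElliptic ∧ W'.IsGloballyMinimal ∧
          (d = -1 ∨ d = 2 ∨ d = -2) ∧ 2 ^ 2 ∣ N ∧ IsIsogenous W (W'.quadraticTwist (d : ℚ)) ∧
          ¬ 2 ^ 2 ∣ W'.conductorNorm ℤ) →
        ¬ (∃ (A : WeierstrassCurve ℚ), A.IsElliptic ∧ A.IsGloballyMinimal ∧ 2 ^ 4 ∣ N ∧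
          2 ^ 2 ∣ A.conductorNorm ℤ ∧ A.conductorNorm ℤ ∣ N ∧ A.conductorNorm ℤ < N ∧
          IsIsogenous W (A.quadraticTwist ((-1 : ℤ) : ℚ))) →
        ¬ (∃ (A : WeierstrassCurve ℚ) (_ : A.IsElliptic) (_ : A.IsGloballyMinimal) (N' : ℕ) (_ : NeZero N')
          (D' : ModularParametrizationData A N') (d : ℤ) (C : WeierstrassCurve ℚ) (u : VariableChange ℚ),
          C.IsElliptic ∧ C.IsGloballyMinimal ∧
          (∀ z ∈ D'.L.lattice, ∃ w ∈ periodLattice D'.f, z = D'.c * w) ∧ (d = 2 ∨ d = -2) ∧ 2 ^ 6 ∣ N ∧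
          2 ^ 2 ∣ A.conductorNorm ℤ ∧ A.conductorNorm ℤ ∣ N ∧
          IsIsogenous W (A.quadraticTwist (d : ℚ)) ∧ u • A.quadraticTwist (d : ℚ) = C ∧
          C.Δ = (d : ℚ) ^ 6 * A.Δ ∧
          (A.conductorNorm ℤ < N ∨ A.minimalDiscriminantInt.natAbs < W.minimalDiscriminantInt.natAbs)) →
        ¬ (∃ (A : WeierstrassCurve ℚ) (_ : A.IsElliptic) (_ : A.IsGloballyMinimal)
          (D' : ModularParametrizationData A N) (q : ℕ) (C : WeierstrassCurve ℚ) (u : VariableChange ℚ),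
          C.IsElliptic ∧ C.IsGloballyMinimal ∧
          (∀ z ∈ D'.L.lattice, ∃ w ∈ periodLattice D'.f, z = D'.c * w) ∧ q.Prime ∧ q ≠ 2 ∧ q ^ 2 ∣ N ∧
          IsIsogenous C W ∧ u • A.quadraticTwist (((-1 : ℤ) ^ (q / 2) * q : ℤ) : ℚ) = C ∧
          C.Δ = ((((-1 : ℤ) ^ (q / 2) * q : ℤ)) : ℚ) ^ 6 * A.Δ ∧
          A.minimalDiscriminantInt.natAbs < W.minimalDiscriminantInt.natAbs) →
        ¬ (3 : ℤ) ∣ D.maninConstant) :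
    Summit.BirchSwinnertonDyer.BirchSwinnertonDyer.Theses.ManinLocalTwoThree.ManinPrimeToThreeAtNine := by
  intro hM hAU hC2 hnf
  suffices key : ∀ (n m : ℕ) (W : WeierstrassCurve ℚ) [W.IsElliptic] [W.IsGloballyMinimal] (N : ℕ)
      [NeZero N] (D : ModularParametrizationData W N), N < n → W.minimalDiscriminantInt.natAbs < m →
      (∀ z ∈ D.L.lattice, ∃ w ∈ periodLattice D.f, z = D.c * w) → 3 ^ 2 ∣ N →
      ¬ (3 : ℤ) ∣ D.maninConstant by
    intro W _ _ N _ D hopt h9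
    exact key (N + 1) (W.minimalDiscriminantInt.natAbs + 1) W N D (Nat.lt_succ_self N)
      (Nat.lt_succ_self _) hopt h9
  intro n
  induction n with
  | zero => intro m W _ _ N _ D hN; exact absurd hN (Nat.not_lt_zero N)
  | succ n ihN =>
    intro m
    induction m with
    | zero => intro W _ _ N _ D _ hm; exact absurd hm (Nat.not_lt_zero _)
    | succ m ihm =>
    intro W _ _ N _ D hNn hmm hopt h9
    have hN : N = W.conductorNorm ℤ :=
      IsNewformOf.level_eq_conductorNorm_of_exists_isNewformOf hnf D.isNewformOf
    have h9W : 3 ^ 2 ∣ W.conductorNorm ℤ := hN ▸ h9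
    -- (i) a `χ₋₃`-untwist to a class semistable at `3`: closed (twist-covered half)
    by_cases h1 : ∃ (W' : WeierstrassCurve ℚ) (d : ℤ), W'.IsElliptic ∧ W'.IsGloballyMinimal ∧
        (d = -3) ∧ IsIsogenous W (W'.quadraticTwist (d : ℚ)) ∧ ¬ 3 ^ 2 ∣ W'.conductorNorm ℤ
    · exact maninLocalTwoThree_maninPrimeToThreeAtNine_twistCovered hM hAU hC2 hnf W D hopt h9 h1
    -- (ii) an odd semistable untwist at `q ≠ 3`: transport + induction on the level
    by_cases h2 : ∃ (W' : WeierstrassCurve ℚ) (q : ℕ), W'.IsElliptic ∧ W'.IsGloballyMinimal ∧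
        q.Prime ∧ q ≠ 2 ∧ q ≠ 3 ∧ q ^ 2 ∣ N ∧
        IsIsogenous W (W'.quadraticTwist (((-1 : ℤ) ^ (q / 2) * q : ℤ) : ℚ)) ∧
        ¬ q ^ 2 ∣ W'.conductorNorm ℤ
    · obtain ⟨W', q, hE', hM', hqp, hq2, hq3, hqN, htw, hqN'⟩ := h2
      haveI := hE'
      haveI := hM'
      haveI : Fact q.Prime := ⟨hqp⟩
      refine maninLocalTwoThree_not_dvd_maninConstant_of_oddUntwist hnf hq2 D hopt hqN htw hqN' ?_
      intro W₁ _ _ N₁ _ D₁ hiso₁ hopt₁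
      have hN₁ : N₁ = W'.conductorNorm ℤ := level_eq_conductorNorm_of_isIsogenous hnf D₁ hiso₁
      have hqNW : q ^ 2 ∣ W.conductorNorm ℤ := hN ▸ hqN
      have hadd : ¬ W.HasGoodReductionAtPrime q ∧ ¬ W.HasMultiplicativeReductionAtPrime q :=
        not_good_and_not_mult_of_sq_dvd_conductorNorm W hqNW
      have hN'N : W'.conductorNorm ℤ ∣ W.conductorNorm ℤ :=
        maninLocalTwoThree_conductorNorm_dvd_of_isIsogenous_twist_pStar hnf hq2 htw hqN' hadd
      have hlt : N₁ < N := by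
        rw [hN₁, hN]
        refine lt_of_le_of_ne (Nat.le_of_dvd (conductorNorm_pos_holds W) hN'N) fun h ↦ hqN' ?_
        rw [h]; exact hqNW
      have h9₁ : 3 ^ 2 ∣ N₁ :=
        hN₁ ▸ maninLocalTwoThree_nine_dvd_conductorNorm_of_isIsogenous_twist_pStar hnf hq2 hq3 htw h9W
      exact ihN _ W₁ N₁ D₁ (by omega) (Nat.lt_succ_self _) hopt₁ h9₁
    -- (iii) a dyadic untwist to a class semistable at `2`: transport + induction on the level
    by_cases h3 : ∃ (W' : WeierstrassCurve ℚ) (d : ℤ), W'.IsElliptic ∧ W'.IsGloballyMinimal ∧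
        (d = -1 ∨ d = 2 ∨ d = -2) ∧ 2 ^ 2 ∣ N ∧ IsIsogenous W (W'.quadraticTwist (d : ℚ)) ∧
        ¬ 2 ^ 2 ∣ W'.conductorNorm ℤ
    · obtain ⟨W', d, hE', hM', hd, h4, htw, h4N'⟩ := h3
      haveI := hE'
      haveI := hM'
      haveI : Fact (Nat.Prime 2) := ⟨Nat.prime_two⟩
      refine maninLocalTwoThree_not_dvd_maninConstant_of_dyadicUntwist_semistable hnf D hopt h4 hd htw
        h4N' ?_
      intro W₁ _ _ N₁ _ D₁ hiso₁ hopt₁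
      have hN₁ : N₁ = W'.conductorNorm ℤ := level_eq_conductorNorm_of_isIsogenous hnf D₁ hiso₁
      have hadd : ¬ W.HasGoodReductionAtPrime 2 ∧ ¬ W.HasMultiplicativeReductionAtPrime 2 :=
        not_good_and_not_mult_of_sq_dvd_conductorNorm W (hN ▸ h4)
      have hN'N : W'.conductorNorm ℤ ∣ W.conductorNorm ℤ :=
        (stub_dyadicTwistConductor hnf hd htw h4N' hadd).1
      have hlt : N₁ < N := by
        rw [hN₁, hN]
        refine lt_of_le_of_ne (Nat.le_of_dvd (conductorNorm_pos_holds W) hN'N) fun h ↦ h4N' ?_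
        rw [h]; exact hN ▸ h4
      have h9₁ : 3 ^ 2 ∣ N₁ :=
        hN₁ ▸ maninLocalTwoThree_nine_dvd_conductorNorm_of_isIsogenous_dyadicTwist hnf hd htw h9W
      exact ihN _ W₁ N₁ D₁ (by omega) (Nat.lt_succ_self _) hopt₁ h9₁
    -- (iv) a `χ₋₄`-untwist to an additive-at-`2` class of lower conductor
    by_cases h4 : ∃ (A : WeierstrassCurve ℚ), A.IsElliptic ∧ A.IsGloballyMinimal ∧ 2 ^ 4 ∣ N ∧
        2 ^ 2 ∣ A.conductorNorm ℤ ∧ A.conductorNorm ℤ ∣ N ∧ A.conductorNorm ℤ < N ∧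
        IsIsogenous W (A.quadraticTwist ((-1 : ℤ) : ℚ))
    · obtain ⟨A, hAe, hAm, h16, h4A, hAN, hlt, htw⟩ := h4
      haveI := hAe
      haveI := hAm
      refine maninLocalTwoThree_not_dvd_maninConstant_of_additiveUntwist_negOne hnf D hopt h16 htw h4A
        hAN ?_
      intro W₁ _ _ N₁ _ D₁ hiso₁ hopt₁
      have hN₁ : N₁ = A.conductorNorm ℤ := level_eq_conductorNorm_of_isIsogenous hnf D₁ hiso₁
      have h9A : 3 ^ 2 ∣ A.conductorNorm ℤ :=
        maninLocalTwoThree_nine_dvd_conductorNorm_of_isIsogenous_dyadicTwist hnf (Or.inl rfl) htw h9W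
      exact ihN _ W₁ N₁ D₁ (by omega) (Nat.lt_succ_self _) hopt₁ (hN₁ ▸ h9A)
    -- (v) an aligned `χ±8`-untwist to a lattice-optimal additive-at-`2` curve, lower or with smaller `|Δ_min|`
    by_cases h5 : ∃ (A : WeierstrassCurve ℚ) (_ : A.IsElliptic) (_ : A.IsGloballyMinimal) (N' : ℕ)
        (_ : NeZero N') (D' : ModularParametrizationData A N') (d : ℤ) (C : WeierstrassCurve ℚ)
        (u : VariableChange ℚ),
        C.IsElliptic ∧ C.IsGloballyMinimal ∧
        (∀ z ∈ D'.L.lattice, ∃ w ∈ periodLattice D'.f, z = D'.c * w) ∧ (d = 2 ∨ d = -2) ∧ 2 ^ 6 ∣ N ∧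
        2 ^ 2 ∣ A.conductorNorm ℤ ∧ A.conductorNorm ℤ ∣ N ∧
        IsIsogenous W (A.quadraticTwist (d : ℚ)) ∧ u • A.quadraticTwist (d : ℚ) = C ∧
        C.Δ = (d : ℚ) ^ 6 * A.Δ ∧
        (A.conductorNorm ℤ < N ∨ A.minimalDiscriminantInt.natAbs < W.minimalDiscriminantInt.natAbs)
    · obtain ⟨A, hAe, hAm, N', hN'0, D', d, C, u, hCe, hCm, hopt', hd, h64, h4A, hAN, htw, hu, hΔ, hlow⟩ :=
        h5
      haveI := hCe
      haveI := hCm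
      have hN' : N' = A.conductorNorm ℤ :=
        IsNewformOf.level_eq_conductorNorm_of_exists_isNewformOf hnf D'.isNewformOf
      refine maninLocalTwoThree_not_dvd_maninConstant_of_additiveUntwist_two_aligned hnf D hopt h64 hd
        D' htw h4A hAN u hu hΔ ?_
      have hd3 : d = -1 ∨ d = 2 ∨ d = -2 := Or.inr hd
      have h9N' : 3 ^ 2 ∣ N' :=
        hN' ▸ maninLocalTwoThree_nine_dvd_conductorNorm_of_isIsogenous_dyadicTwist hnf hd3 htw h9W
      by_cases hlt : A.conductorNorm ℤ < N
      · exact ihN _ A N' D' (by omega) (Nat.lt_succ_self _) hopt' h9N'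
      · have hmA : A.minimalDiscriminantInt.natAbs < W.minimalDiscriminantInt.natAbs := hlow.resolve_left hlt
        have hle : N' ≤ N := hN' ▸ Nat.le_of_dvd (Nat.pos_of_ne_zero (NeZero.ne N)) hAN
        exact ihm A N' D' (by omega) (by omega) hopt' h9N'
    -- (vi) an aligned same-level `χ_{q*}`-untwist (odd `q`, `q² ∣ N`, `q = 3` allowed), smaller `|Δ_min|`
    by_cases h6 : ∃ (A : WeierstrassCurve ℚ) (_ : A.IsElliptic) (_ : A.IsGloballyMinimal)
        (D' : ModularParametrizationData A N) (q : ℕ) (C : WeierstrassCurve ℚ) (u : VariableChange ℚ),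
        C.IsElliptic ∧ C.IsGloballyMinimal ∧
        (∀ z ∈ D'.L.lattice, ∃ w ∈ periodLattice D'.f, z = D'.c * w) ∧ q.Prime ∧ q ≠ 2 ∧ q ^ 2 ∣ N ∧
        IsIsogenous C W ∧ u • A.quadraticTwist (((-1 : ℤ) ^ (q / 2) * q : ℤ) : ℚ) = C ∧
        C.Δ = ((((-1 : ℤ) ^ (q / 2) * q : ℤ)) : ℚ) ^ 6 * A.Δ ∧
        A.minimalDiscriminantInt.natAbs < W.minimalDiscriminantInt.natAbs
    · obtain ⟨A, hAe, hAm, D', q, C, u, hCe, hCm, hopt', hqp, hq2, hqN, hCW, hu, hΔ, hmA⟩ := h6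
      haveI := hCe
      haveI := hCm
      haveI : Fact q.Prime := ⟨hqp⟩
      have hadd : ¬ W.HasGoodReductionAtPrime q ∧ ¬ W.HasMultiplicativeReductionAtPrime q :=
        not_good_and_not_mult_of_sq_dvd_conductorNorm W (hN ▸ hqN)
      refine maninLocalTwoThree_not_dvd_maninConstant_of_untwist_pStar_aligned hq2 D hopt D' dvd_rfl hqN
        hadd u hu hCW hΔ ?_
      exact ihm A N D' hNn (by omega) hopt' h9
    · exact H hM hAU hC2 hnf W D hopt h9 h1 h2 h3 h4 h5 h6

end Summit.BirchSwinnertonDyer.BirchSwinnertonDyer.Theorems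

end
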